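import Summits.PneNP.PneNP.Theorems.ChebyshevTracialDesignTightFreeSpectral
import Summits.PneNP.PneNP.Theorems.ChebyshevTracialDesignTightEvenEigenvalues
import HarnessLib

/-!
# Cell pnp-psdrank, route `ChebyshevTracialDesign`: tight-free rectangles of cuts × perfect matchings are spectrally small —
# the σ₂ brick with an explicit, unconditional constant

Harmonic backbone, brick 5f (the σ₂ brick of the r = 1 rung, assembled). Rectangles of a nonnegative factorisation of Rothvoß's
slack matrix avoid the tight pairs `cc(U,M) = 1` [cite: Rothvoss2017, §2 (PDF p. 6)]. For `t = 2c+1` with `2t ≤ n`, every family `X`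
of `t`-cuts and every set `Y` of perfect matchings of `K_n` WITHOUT a tight pair satisfy
  `|X| · |Y| · d_C² ≤ Λ(n,c) · C(n,t) · (C(n,t) − |X|)`,   `Λ(n,c) := Σ_{1 ≤ κ' ≤ c} λ_{2κ'}`        (`tightFree_card_mul_card_le_explicit`)
where `d_C` = the number of tight `t`-cuts of a perfect matching and `λ_{2κ'}` are the EXACT even ladder eigenvalues of the tight Gram
kernel (brick 5e, `kernelEigen_tight_even_eq`; the odd ones vanish, brick 5c); i.e. `μν ≤ (1−μ)·Λ/λ₀` with `λ₀ = d_R d_C`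
(lit's `kernelEigen_zero_eq_rowSum_mul_colSum`). Numerically `Λ = (1 + O(1/n))·λ₂` and `λ₂/λ₀ = (1 − o(1))/n` (MEMO-7 §2: the λ_{2κ'}
decrease in κ'; n·λ₂/λ₀ = 0.990 at n = 400), so this is "tight-free ⇒ μν ≲ 1/n" [cite: GodsilMeagher2015, §15.2 (perfect matching
scheme)] [cite: BrouwerHaemers2012, Prop. 4.3.2 (expander mixing)]. WHAT THIS IS NOT: the inequality `Λ ≤ (1+ε)λ₂` / `λ₂ ≤ λ₀/n` is not
proved here (pure real-number estimates on the closed forms, left to the next brick); nothing on psd rank. Supports crux stmt-PneNP-19878.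
-/

set_option linter.dupNamespace false -- `Summit.PneNP.PneNP.…`: summit = sub-problem (D-0017)

noncomputable section

namespace Summit.PneNP.PneNP.Theorems.ChebyshevTracialDesignTightFreeExplicit

open Finset Literature.Combinatorics.AssociationSchemes Literature.Combinatorics.AssociationSchemes.JohnsonHarmonics
open Literature.Combinatorics.AssociationSchemes.JohnsonSpectrum
open Literature.Barriers.PneNP
open Summit.PneNP.PneNP.Theorems.ChebyshevTracialDesignTightFreeSpectral
open Summit.PneNP.PneNP.Theorems.ChebyshevTracialDesignTightEvenEigenvalues

variable {n : ℕ}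

/-- **The σ₂ brick, explicit and unconditional.** For `t = 2c+1`, `2t ≤ n`, every tight-free rectangle `X × Y` of `t`-cuts and
perfect matchings satisfies `|X|·|Y|·d_C² ≤ (Σ_{1≤κ'≤c} λ_{2κ'})·C(n,t)·(C(n,t)−|X|)` with the closed-form even eigenvalues
`λ_{2κ'} = ((t−2κ')!·(n−2c−2κ')·C(n/2−2κ',c−κ'))²·Σ_{d even} C(2κ',d)pm(2κ'−d)pm(d)²pm(n−2κ'−d) / Π_{i<t−2κ'} λ_{2κ'}(i)`. -/
theorem tightFree_card_mul_card_le_explicit {c : ℕ} (ht : 2 * (2 * c + 1) ≤ n) (M₀ : PMatch n)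
    (X : Finset (Finset (Fin n))) (hX : X ⊆ univ.powersetCard (2 * c + 1)) (Y : Finset (PMatch n))
    (hXY : ∀ U ∈ X, ∀ M ∈ Y, (U.filter fun x => M.2.partner x ∉ U).card ≠ 1) :
    (X.card : ℝ) * Y.card *
        ((((powersetCard (2 * c + 1) (univ : Finset (Fin n))).filter
          (fun U => (U.filter fun x => M₀.2.partner x ∉ U).card = 1)).card : ℝ)) ^ 2 ≤
      (∑ κ' ∈ Icc 1 c,
        (((2 * c + 1 - 2 * κ').factorial : ℝ) *
            (((n : ℝ) - (2 * c : ℕ) - (2 * κ' : ℕ)) * (((n / 2 - 2 * κ').choose (c - κ') : ℕ) : ℝ))) ^ 2 *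
          (∑ d ∈ range (2 * κ' + 1),
            if Even d then ((2 * κ').choose d : ℝ) * pmCount (2 * κ' - d) * pmCount d ^ 2 * pmCount (n - 2 * κ' - d)
            else 0) /
          ∏ i ∈ range (2 * c + 1 - 2 * κ'), ladder n (2 * κ') i) *
        (n.choose (2 * c + 1) : ℝ) * ((n.choose (2 * c + 1) : ℝ) - X.card) := by
  -- each summand is a nonnegative eigenvalue
  have hterm_nonneg : ∀ κ' ∈ Icc 1 c, 0 ≤
      (((2 * c + 1 - 2 * κ').factorial : ℝ) *
          (((n : ℝ) - (2 * c : ℕ) - (2 * κ' : ℕ)) * (((n / 2 - 2 * κ').choose (c - κ') : ℕ) : ℝ))) ^ 2 *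
        (∑ d ∈ range (2 * κ' + 1),
          if Even d then ((2 * κ').choose d : ℝ) * pmCount (2 * κ' - d) * pmCount d ^ 2 * pmCount (n - 2 * κ' - d)
          else 0) /
        ∏ i ∈ range (2 * c + 1 - 2 * κ'), ladder n (2 * κ') i := by
    intro κ' hκ'
    rw [mem_Icc] at hκ'
    refine div_nonneg (mul_nonneg (sq_nonneg _) (sum_nonneg fun d _ => ?_))
      (ladderProd_range_pos (by omega) ht).le
    split_ifs
    · positivity
    · exact le_refl _
  refine tightFree_card_mul_card_le ⟨c, rfl⟩ ht (sum_nonneg hterm_nonneg) ?_ M₀ X hX Y hXY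
  intro κ hA κ' h1 h2
  have hκc : κ' ≤ c := by omega
  rw [kernelEigen_tight_even_eq ht hκc κ hA]
  exact single_le_sum hterm_nonneg (mem_Icc.2 ⟨h1, hκc⟩)

end Summit.PneNP.PneNP.Theorems.ChebyshevTracialDesignTightFreeExplicit
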